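import Mathlib
import Summits.Ventures.PercRepro2.CoinChainAWorldLemmas
import Summits.Ventures.PercRepro2.CoinChainBlind

/-!
# The pure AND-switch chain with ONE head-aware non-entry — the `off` weight
(blind cell PercRepro2, night-2 g20; proofs/NIGHT2-DARC.md §60.11)

Beyond blindness: a single non-entry `z ∈ U ∖ ent'` may have routes into the head (the head is
blind to the OTHER non-entries: `c W = c (W ∩ insert z ent')`), provided the markers vanish on
the entry-free clusters (`x W = 0 = y W` for `W ∩ ent' = ∅` — e.g. point markers that are
entries).  The lifted law of `CoinChainBlindLemmas.lean` is still an OR-tail pair: on the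
entry-free ideal the `off` weight `c − ρ·d` is two-valued by the `z`-bit, the (ideal, entered)
cases follow from the ratio property `c (T ∪ {z}) / c T ≤ c {z} / c ∅ ≤ d {z} / d ∅`
(`blindOffZ_lsm`), and the (on, off) cases from the `cross_cd` inequality of §59.3
(`blindOff_crossZ`); the entry-free correction is a sum of nonnegative terms because the markers
vanish there.  The theorem is assembled in `CoinChainOneAware.lean`.
-/

namespace Summit.Ventures.PercRepro2.Coin

open Classical

section ChainOneAwareLemmas

variable {V : Type*} [DecidableEq V] {R : Type*} [Field R] [LinearOrder R] [IsStrictOrderedRing R]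

omit [Field R] [LinearOrder R] [IsStrictOrderedRing R] in
/-- Blindness to the non-entries other than `z`: an entry-free cluster carries the value at
`∅` or at `{z}` according to its `z`-bit. -/
lemma blindZ_value (ent' : Finset V) (z : V) (c : Finset V → R)
    (hbc : ∀ W, c W = c (W ∩ insert z ent')) {W : Finset V} (h : ¬ ∃ r ∈ ent', r ∈ W) :
    c W = if z ∈ W then c {z} else c ∅ := by
  rw [hbc W]
  split_ifs with hz
  · congr 1
    ext v; simp only [Finset.mem_inter, Finset.mem_insert, Finset.mem_singleton]
    constructor
    · rintro ⟨hvW, rfl | hv⟩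
      · rfl
      · exact absurd ⟨v, hv, hvW⟩ h
    · rintro rfl; exact ⟨hz, Or.inl rfl⟩
  · rw [inter_ent_eq_empty_of_not]
    rintro ⟨r, hr, hrW⟩
    rw [Finset.mem_insert] at hr
    rcases hr with rfl | hr
    · exact hz hrW
    · exact h ⟨r, hr, hrW⟩

omit [Field R] [LinearOrder R] [IsStrictOrderedRing R] in
/-- The value of an entered cluster joined with an entry-free one: only the `z`-bit matters. -/
lemma blindZ_union (ent' : Finset V) (z : V) (c : Finset V → R)
    (hbc : ∀ W, c W = c (W ∩ insert z ent')) {s t : Finset V} (ht : ¬ ∃ r ∈ ent', r ∈ t) :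
    c (s ∪ t) = if z ∈ t then c (s ∪ {z}) else c s := by
  split_ifs with hz
  · rw [hbc (s ∪ t), hbc (s ∪ {z})]
    congr 1
    ext v; simp only [Finset.mem_inter, Finset.mem_union, Finset.mem_insert, Finset.mem_singleton]
    constructor
    · rintro ⟨hv | hv, hv'⟩
      · exact ⟨Or.inl hv, hv'⟩
      · rcases hv' with rfl | hv'
        · exact ⟨Or.inr rfl, Or.inl rfl⟩
        · exact absurd ⟨v, hv', hv⟩ ht
    · rintro ⟨hv | rfl, hv'⟩
      · exact ⟨Or.inl hv, hv'⟩
      · exact ⟨Or.inr hz, Or.inl rfl⟩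
  · rw [hbc (s ∪ t), hbc s]
    congr 1
    ext v; simp only [Finset.mem_inter, Finset.mem_union, Finset.mem_insert]
    constructor
    · rintro ⟨hv | hv, hv'⟩
      · exact ⟨hv, hv'⟩
      · rcases hv' with rfl | hv'
        · exact absurd hv hz
        · exact absurd ⟨v, hv', hv⟩ ht
    · rintro ⟨hv, hv'⟩; exact ⟨Or.inl hv, hv'⟩

/-- **The `z`-step**: `(c {z} − ρ·d {z}) · e S ≤ (c ∅ − ρ·d ∅) · e (S ∪ {z})` for `z ∉ S` — from the
joint inequality `c {z} · e S ≤ c ∅ · e (S ∪ {z})` and §59.3's `cross_cd`. -/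
lemma z_step (c d e : Finset V → R) (z : V) (ρ : R) (hρ0 : 0 ≤ ρ) (hρ1 : ρ ≤ 1)
    (hc0 : ∀ W, 0 ≤ c W) (hd0 : ∀ W, 0 ≤ d W) (he0 : ∀ W, 0 ≤ e W)
    (hdc : ∀ W, d W ≤ c W) (hec : ∀ W, e W ≤ c W)
    (hcc : ∀ s t, c s * c t ≤ c (s ∩ t) * c (s ∪ t))
    (hce : ∀ s t, c s * e t ≤ c (s ∩ t) * e (s ∪ t))
    (hratio : ∀ s t, s ⊆ t → d s * c t ≤ c s * d t)
    (hratio_e : ∀ s t, s ⊆ t → e s * c t ≤ c s * e t) (S : Finset V) (hz : z ∉ S) :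
    (c {z} - ρ * d {z}) * e S ≤ (c ∅ - ρ * d ∅) * e (S ∪ {z}) := by
  have hi : ({z} : Finset V) ∩ S = ∅ := by
    ext v; simp only [Finset.mem_inter, Finset.mem_singleton, Finset.notMem_empty, iff_false]
    rintro ⟨rfl, hv⟩; exact hz hv
  have hu : ({z} : Finset V) ∪ S = S ∪ {z} := Finset.union_comm _ _
  have h1 := cross_cd c d e hc0 hd0 he0 hdc hec hcc hratio hratio_e {z} S
  rw [hi, hu] at h1
  have h2 := hce {z} S
  rw [hi, hu] at h2
  have h1ρ : 0 ≤ 1 - ρ := by linarith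
  calc (c {z} - ρ * d {z}) * e S = (1 - ρ) * (c {z} * e S) + ρ * ((c {z} - d {z}) * e S) := by ring
    _ ≤ (1 - ρ) * (c ∅ * e (S ∪ {z})) + ρ * ((c ∅ - d ∅) * e (S ∪ {z})) :=
        add_le_add (mul_le_mul_of_nonneg_left h2 h1ρ) (mul_le_mul_of_nonneg_left h1 hρ0)
    _ = (c ∅ - ρ * d ∅) * e (S ∪ {z}) := by ring

/-- **`blindOff` is log-supermodular with one head-aware non-entry `z`.** -/
lemma blindOffZ_lsm (ent' : Finset V) (z : V) (ρ : R) (c d : Finset V → R) (hρ0 : 0 ≤ ρ) (hρ1 : ρ ≤ 1)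
    (hc0 : ∀ W, 0 ≤ c W) (hd0 : ∀ W, 0 ≤ d W) (hdc : ∀ W, d W ≤ c W)
    (hcc : ∀ s t, c s * c t ≤ c (s ∩ t) * c (s ∪ t))
    (hratio : ∀ s t, s ⊆ t → d s * c t ≤ c s * d t)
    (hbc : ∀ W, c W = c (W ∩ insert z ent')) (hbd : ∀ W, d W = d (W ∩ insert z ent')) (s t : Finset V) :
    blindOff ent' ρ c d s * blindOff ent' ρ c d t ≤
      blindOff ent' ρ c d (s ∩ t) * blindOff ent' ρ c d (s ∪ t) := by
  have h1ρ : 0 ≤ 1 - ρ := by linarith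
  have hstep := z_step c d c z ρ hρ0 hρ1 hc0 hd0 hc0 hdc (fun W => le_rfl) hcc hcc hratio
    (fun s t _ => by rw [mul_comm]) 
  by_cases hs : ∃ r ∈ ent', r ∈ s <;> by_cases ht : ∃ r ∈ ent', r ∈ t
  · -- both entered: no blindness needed
    have hu : ∃ r ∈ ent', r ∈ s ∪ t := meets_union_iff.2 (Or.inl hs)
    by_cases hi : ∃ r ∈ ent', r ∈ s ∩ t
    · unfold blindOff
      rw [if_pos hs, if_pos ht, if_pos hi, if_pos hu]
      have := hcc s t
      calc (1 - ρ) * c s * ((1 - ρ) * c t) = (1 - ρ) * (1 - ρ) * (c s * c t) := by ring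
        _ ≤ (1 - ρ) * (1 - ρ) * (c (s ∩ t) * c (s ∪ t)) :=
            mul_le_mul_of_nonneg_left this (mul_nonneg h1ρ h1ρ)
        _ = (1 - ρ) * c (s ∩ t) * ((1 - ρ) * c (s ∪ t)) := by ring
    · unfold blindOff
      rw [if_pos hs, if_pos ht, if_neg hi, if_pos hu]
      have h1 := hcc s t
      have h2 := one_sub_mul_le_sub ρ (c (s ∩ t)) (d (s ∩ t)) hρ0 (hdc _)
      have h3 : 0 ≤ (1 - ρ) * c (s ∪ t) := mul_nonneg h1ρ (hc0 _)
      calc (1 - ρ) * c s * ((1 - ρ) * c t) = (1 - ρ) * (1 - ρ) * (c s * c t) := by ring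
        _ ≤ (1 - ρ) * (1 - ρ) * (c (s ∩ t) * c (s ∪ t)) :=
            mul_le_mul_of_nonneg_left h1 (mul_nonneg h1ρ h1ρ)
        _ = ((1 - ρ) * c (s ∩ t)) * ((1 - ρ) * c (s ∪ t)) := by ring
        _ ≤ (c (s ∩ t) - ρ * d (s ∩ t)) * ((1 - ρ) * c (s ∪ t)) :=
            mul_le_mul_of_nonneg_right h2 h3
  · -- `s` entered, `t` entry-free
    have hi : ¬ ∃ r ∈ ent', r ∈ s ∩ t := not_meets_inter_right ht
    have hu : ∃ r ∈ ent', r ∈ s ∪ t := meets_union_iff.2 (Or.inl hs)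
    unfold blindOff
    rw [if_pos hs, if_neg ht, if_neg hi, if_pos hu, blindZ_value ent' z c hbc ht, blindZ_value ent' z d hbd ht,
      blindZ_value ent' z c hbc hi, blindZ_value ent' z d hbd hi, blindZ_union ent' z c hbc ht]
    by_cases hzt : z ∈ t
    · by_cases hzs : z ∈ s
      · have hzi : z ∈ s ∩ t := Finset.mem_inter.2 ⟨hzs, hzt⟩
        rw [if_pos hzt, if_pos hzt, if_pos hzi, if_pos hzi, if_pos hzt, Finset.union_eq_left.mpr (by simpa using hzs)]
        all_goals first | exact le_rfl | (ring_nf; exact le_rfl)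
      · have hzi : z ∉ s ∩ t := fun h => hzs (Finset.mem_inter.1 h).1
        rw [if_pos hzt, if_pos hzt, if_neg hzi, if_neg hzi, if_pos hzt]
        have := hstep s hzs
        calc (1 - ρ) * c s * (c {z} - ρ * d {z}) = (1 - ρ) * ((c {z} - ρ * d {z}) * c s) := by ring
          _ ≤ (1 - ρ) * ((c ∅ - ρ * d ∅) * c (s ∪ {z})) := mul_le_mul_of_nonneg_left this h1ρ
          _ = (c ∅ - ρ * d ∅) * ((1 - ρ) * c (s ∪ {z})) := by ring
    · have hzi : z ∉ s ∩ t := fun h => hzt (Finset.mem_inter.1 h).2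
      rw [if_neg hzt, if_neg hzt, if_neg hzi, if_neg hzi, if_neg hzt]
      all_goals first | exact le_rfl | (ring_nf; exact le_rfl)
  · -- `s` entry-free, `t` entered: symmetric
    have hi : ¬ ∃ r ∈ ent', r ∈ s ∩ t := not_meets_inter_left hs
    have hu : ∃ r ∈ ent', r ∈ s ∪ t := meets_union_iff.2 (Or.inr ht)
    have hu' : s ∪ t = t ∪ s := Finset.union_comm _ _
    unfold blindOff
    rw [if_neg hs, if_pos ht, if_neg hi, if_pos hu, blindZ_value ent' z c hbc hs, blindZ_value ent' z d hbd hs,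
      blindZ_value ent' z c hbc hi, blindZ_value ent' z d hbd hi, hu', blindZ_union ent' z c hbc hs]
    by_cases hzs : z ∈ s
    · by_cases hzt : z ∈ t
      · have hzi : z ∈ s ∩ t := Finset.mem_inter.2 ⟨hzs, hzt⟩
        rw [if_pos hzs, if_pos hzs, if_pos hzi, if_pos hzi, if_pos hzs, Finset.union_eq_left.mpr (by simpa using hzt)]
      · have hzi : z ∉ s ∩ t := fun h => hzt (Finset.mem_inter.1 h).2
        rw [if_pos hzs, if_pos hzs, if_neg hzi, if_neg hzi, if_pos hzs]
        have := hstep t hzt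
        calc (c {z} - ρ * d {z}) * ((1 - ρ) * c t) = (1 - ρ) * ((c {z} - ρ * d {z}) * c t) := by ring
          _ ≤ (1 - ρ) * ((c ∅ - ρ * d ∅) * c (t ∪ {z})) := mul_le_mul_of_nonneg_left this h1ρ
          _ = (c ∅ - ρ * d ∅) * ((1 - ρ) * c (t ∪ {z})) := by ring
    · have hzi : z ∉ s ∩ t := fun h => hzs (Finset.mem_inter.1 h).1
      rw [if_neg hzs, if_neg hzs, if_neg hzi, if_neg hzi, if_neg hzs]
  · -- both entry-free: the `z`-bits decide
    have hi : ¬ ∃ r ∈ ent', r ∈ s ∩ t := not_meets_inter_left hs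
    have hu : ¬ ∃ r ∈ ent', r ∈ s ∪ t := fun h => by
      rcases meets_union_iff.1 h with h | h; exact hs h; exact ht h
    unfold blindOff
    rw [if_neg hs, if_neg ht, if_neg hi, if_neg hu, blindZ_value ent' z c hbc hs, blindZ_value ent' z d hbd hs,
      blindZ_value ent' z c hbc ht, blindZ_value ent' z d hbd ht, blindZ_value ent' z c hbc hi,
      blindZ_value ent' z d hbd hi, blindZ_value ent' z c hbc hu, blindZ_value ent' z d hbd hu]
    by_cases hzs : z ∈ s <;> by_cases hzt : z ∈ t
    · rw [if_pos hzs, if_pos hzs, if_pos hzt, if_pos hzt, if_pos (Finset.mem_inter.2 ⟨hzs, hzt⟩),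
        if_pos (Finset.mem_inter.2 ⟨hzs, hzt⟩), if_pos (Finset.mem_union_left _ hzs),
        if_pos (Finset.mem_union_left _ hzs)]
    · rw [if_pos hzs, if_pos hzs, if_neg hzt, if_neg hzt, if_neg (fun h => hzt (Finset.mem_inter.1 h).2),
        if_neg (fun h => hzt (Finset.mem_inter.1 h).2), if_pos (Finset.mem_union_left _ hzs),
        if_pos (Finset.mem_union_left _ hzs)]
      all_goals first | exact le_rfl | (ring_nf; exact le_rfl)
    · rw [if_neg hzs, if_neg hzs, if_pos hzt, if_pos hzt, if_neg (fun h => hzs (Finset.mem_inter.1 h).1),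
        if_neg (fun h => hzs (Finset.mem_inter.1 h).1), if_pos (Finset.mem_union_right _ hzt),
        if_pos (Finset.mem_union_right _ hzt)]
    · rw [if_neg hzs, if_neg hzs, if_neg hzt, if_neg hzt, if_neg (fun h => hzs (Finset.mem_inter.1 h).1),
        if_neg (fun h => hzs (Finset.mem_inter.1 h).1),
        if_neg (fun h => by rcases Finset.mem_union.1 h with h | h; exact hzs h; exact hzt h),
        if_neg (fun h => by rcases Finset.mem_union.1 h with h | h; exact hzs h; exact hzt h)]

/-- **The cross inequality with one head-aware non-entry**: `e s · blindOff t ≤ blindOff (s ∩ t) · e (s ∪ t)`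
for `e ∈ {d, d'}` (`e ≤ c`, `(c, e)` jointly lsm, `e / c` increasing, blind off `z`). -/
lemma blindOff_crossZ (ent' : Finset V) (z : V) (ρ : R) (c d e : Finset V → R) (hρ0 : 0 ≤ ρ) (hρ1 : ρ ≤ 1)
    (hc0 : ∀ W, 0 ≤ c W) (hd0 : ∀ W, 0 ≤ d W) (he0 : ∀ W, 0 ≤ e W)
    (hdc : ∀ W, d W ≤ c W) (hec : ∀ W, e W ≤ c W)
    (hcc : ∀ s t, c s * c t ≤ c (s ∩ t) * c (s ∪ t))
    (hce : ∀ s t, c s * e t ≤ c (s ∩ t) * e (s ∪ t))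
    (hratio : ∀ s t, s ⊆ t → d s * c t ≤ c s * d t)
    (hratio_e : ∀ s t, s ⊆ t → e s * c t ≤ c s * e t)
    (hbc : ∀ W, c W = c (W ∩ insert z ent')) (hbd : ∀ W, d W = d (W ∩ insert z ent'))
    (hbe : ∀ W, e W = e (W ∩ insert z ent')) (s t : Finset V) :
    e s * blindOff ent' ρ c d t ≤ blindOff ent' ρ c d (s ∩ t) * e (s ∪ t) := by
  have h1ρ : 0 ≤ 1 - ρ := by linarith
  by_cases ht : ∃ r ∈ ent', r ∈ t
  · have h0 : c t * e s ≤ c (s ∩ t) * e (s ∪ t) := by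
      have := hce t s
      rwa [Finset.inter_comm, Finset.union_comm] at this
    by_cases hi : ∃ r ∈ ent', r ∈ s ∩ t
    · unfold blindOff
      rw [if_pos ht, if_pos hi]
      calc e s * ((1 - ρ) * c t) = (1 - ρ) * (c t * e s) := by ring
        _ ≤ (1 - ρ) * (c (s ∩ t) * e (s ∪ t)) := mul_le_mul_of_nonneg_left h0 h1ρ
        _ = (1 - ρ) * c (s ∩ t) * e (s ∪ t) := by ring
    · unfold blindOff
      rw [if_pos ht, if_neg hi]
      have h2 := one_sub_mul_le_sub ρ (c (s ∩ t)) (d (s ∩ t)) hρ0 (hdc _)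
      calc e s * ((1 - ρ) * c t) = (1 - ρ) * (c t * e s) := by ring
        _ ≤ (1 - ρ) * (c (s ∩ t) * e (s ∪ t)) := mul_le_mul_of_nonneg_left h0 h1ρ
        _ = ((1 - ρ) * c (s ∩ t)) * e (s ∪ t) := by ring
        _ ≤ (c (s ∩ t) - ρ * d (s ∩ t)) * e (s ∪ t) := mul_le_mul_of_nonneg_right h2 (he0 _)
  · have hi : ¬ ∃ r ∈ ent', r ∈ s ∩ t := not_meets_inter_right ht
    unfold blindOff
    rw [if_neg ht, if_neg hi, blindZ_value ent' z c hbc ht, blindZ_value ent' z d hbd ht,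
      blindZ_value ent' z c hbc hi, blindZ_value ent' z d hbd hi, blindZ_union ent' z e hbe ht]
    by_cases hzt : z ∈ t
    · by_cases hzs : z ∈ s
      · have hzi : z ∈ s ∩ t := Finset.mem_inter.2 ⟨hzs, hzt⟩
        rw [if_pos hzt, if_pos hzt, if_pos hzi, if_pos hzi, if_pos hzt,
          Finset.union_eq_left.mpr (by simpa using hzs)]
        exact le_of_eq (by ring)
      · have hzi : z ∉ s ∩ t := fun h => hzs (Finset.mem_inter.1 h).1
        rw [if_pos hzt, if_pos hzt, if_neg hzi, if_neg hzi, if_pos hzt]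
        have := z_step c d e z ρ hρ0 hρ1 hc0 hd0 he0 hdc hec hcc hce hratio hratio_e s hzs
        linarith [this]
    · have hzi : z ∉ s ∩ t := fun h => hzt (Finset.mem_inter.1 h).2
      rw [if_neg hzt, if_neg hzt, if_neg hzi, if_neg hzi, if_neg hzt]
      exact le_of_eq (by ring)

end ChainOneAwareLemmas

end Summit.Ventures.PercRepro2.Coin
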